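import Summits.HodgeConjecture.CorCM.MumfordTateRankSevenTypeThreeConverse
import Literature.Algebra.Lie.QuaternionCentralizerSkewDimensionOrthogonal
import Literature.RingTheory.CentralSimple.PositiveInvolutionQuaternionTotallyReal
import HarnessLib

/-!
# Type II over `ℚ`: the Lefschetz bound `dim Lie Hg(H¹B) ≤ m(2m+1)` for a simple abelian variety of dimension `2m` with totally
# indefinite quaternion multiplication over `ℚ`

COR-CM (cell `pub-hodgecm2`, seat `b27` gen 44, count-neutral Mumford–Tate-rank ladder; theorems only, no definition, no named
fact; UNCONDITIONAL — nothing here uses or asserts HC_CM).  Companion of `CorCM/MumfordTateRankTypeThreeLefschetz` (type III: totally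
DEFINITE quaternion algebra, Rosati = canonical involution, bound `m(2m-1)`).  For a totally INDEFINITE quaternion algebra `D` over `ℚ`
(Albert type II) the Rosati involution is `x ↦ u⁻¹x̄u` with `u² = α < 0` (Lange Thm. 2.6.5 (b), the tree's
`isPositiveAntiInvolution_iff_of_isOfFirstKind`); in a quaternionic basis `i = u`, `j` through `u` (the tree's
`exists_algEquiv_quaternionAlgebra_apply_eq`) it reads `i ↦ -i`, `j ↦ +j`, so the pair acts on `H¹B` by anticommuting operators, `i`
`ψ`-SKEW and `j` `ψ`-SYMMETRIC, and the orthogonal-type count of `Literature/Algebra/Lie/QuaternionCentralizerSkewDimensionOrthogonal`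
applies:

* `exists_quaternion_pair_of_isTotallyIndefinite` — the set-up (`i† = -i`, `j† = +j`).
* `finrank_centralizer_inf_skewAdjoint_eq_orth` — `8 · dim (C(i, j) ∩ 𝔰𝔭(ψ)) = d² + 2d` for such a pair on a polarized Hodge
  structure with antisymmetric `ψ` (`d = dim V`).
* **`finrank_hodgeLie_hodge_one_le_of_isTotallyIndefinite`**, **`mtRank_hodge_one_le_of_isTotallyIndefinite`** — THE LEFSCHETZ BOUND for
  type II over `ℚ`: `B` simple, `dim B = 2m`, `End⁰B` a totally indefinite quaternion algebra over `ℚ` ⟹ `dim Lie Hg(H¹B) ≤ m(2m+1)`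
  (`= dim 𝔰𝔭_{2m}`), `dim MT(H¹B) ≤ m(2m+1) + 1` — Milne 1999 §2, Summary: the type-II Lefschetz group has dimension `g²/2f + g/2`
  (`f = 1`, `g = 2m`); Moonen–Zarhin §1 `Hg(X) ⊂ Sp_D(V, φ)`.
* `mtRank_hodge_one_mem_of_isSimple_fourfold_of_isTotallyIndefinite` — for a simple FOURFOLD with indefinite quaternion
  multiplication over `ℚ`: `dim MT(H¹B) ∈ {7, 9, 10, 11}` (`≤ 11` here; `≥ 4`, `≠ 4` (`dim_ℚ End⁰B = 4 ≠ 16`), `∉ {5, 6, 8}` (no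
  type IV) by the lower rungs; in print `t = 11` by Moonen–Zarhin Thm. (0.1) (4), not yet in the tree).

## References
* [Milne1999LefschetzClasses] J. S. Milne, Duke Math. J. 96 (1999), §2 (type II) and Summary (`dim = g²/2f + g/2`).
* [MoonenZarhin1999LowDim] B. Moonen, Yu. Zarhin, Math. Ann. 315 (1999), §1 (`Hg(X) ⊂ Sp_D(V, φ)`).
* [Lange2023AbelianVarietiesComplex] H. Lange, *Abelian Varieties over the Complex Numbers* (2023), §2.6.2 Thm. 2.6.5 (b).
-/

noncomputable section

open scoped TensorProduct Quaternion
open CategoryTheory CategoryTheory.Limits Module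

namespace Summit.HodgeConjecture.CorCM

open Literature.AlgebraicGeometry.Motives
open Literature.AlgebraicGeometry.Motives.AbelianVariety
open Literature.AlgebraicGeometry.Motives.HodgeStructure
open Literature.AlgebraicGeometry.HodgeTheory
open Literature.AlgebraicGeometry.ComplexMultiplication (bettiRep bettiRep_injective)
open Literature.AlgebraicGeometry.Milne1999 (IsOfCMType)
open Literature.NumberTheory.Automorphic (IsQuaternionAlgebra IsTotallyDefinite standardInvolution
  standardInvolution_algEquiv standardInvolution_quaternionAlgebra)
open Literature.RingTheory.CentralSimple
open Literature.Algebra.Lie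

variable [HodgeTensorFacts.{0, 0}]

/-! ## §1 The set-up: `i† = -i`, `j† = +j` -/

/-- **An anticommuting quaternion pair in `End_Hdg(H¹B)` with `i† = -i`, `j† = +j`**, for `B` simple with `End⁰B` a totally
INDEFINITE quaternion algebra over `ℚ` and a polarization `ψ` of `H¹B`: the Rosati involution is `x ↦ u⁻¹x̄u` with `u² = α < 0`
(Lange Thm. 2.6.5 (b)), and in a quaternionic basis `i = u`, `j` through `u` it is `i ↦ -i`, `j ↦ j`; transported along Riemann's
anti-isomorphism `bettiRep`. [cite: Lange2023AbelianVarietiesComplex, §2.6.2 Thm. 2.6.5 (b)] [cite: MoonenZarhin1999LowDim, §1] -/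
theorem exists_quaternion_pair_of_isTotallyIndefinite {B : AbelianVariety ℂ} {k : ℕ} (hB : IsSmoothProjective k B.X)
    (hBs : B.IsSimple) [IsQuaternionAlgebra ℚ B.endAlgebra] (hind : IsTotallyIndefinite ℚ B.endAlgebra)
    [Module.Finite ℚ (bettiCohomology B.X 1)] (ψ : (BettiUniverse.hodge exists_isReal_hodgeModel_holds hB 1).Polarization) :
    ∃ (a b : ℚ) (i j : Module.End ℚ (bettiCohomology B.X 1)), a ≠ 0 ∧ b ≠ 0 ∧
      i * i = algebraMap ℚ _ a ∧ j * j = algebraMap ℚ _ b ∧ i * j = -(j * i) ∧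
      i ∈ (BettiUniverse.hodge exists_isReal_hodgeModel_holds hB 1).endAlg ∧
      j ∈ (BettiUniverse.hodge exists_isReal_hodgeModel_holds hB 1).endAlg ∧ ψ.adjoint i = -i ∧ ψ.adjoint j = j := by
  classical
  have hk : B.dim = k := schemeDim_eq_holds hB
  subst hk
  have hHD : exists_isReal_hodgeModel := exists_isReal_hodgeModel_holds
  have hI : hodgePQ_independent_of_hodgeModel := hodgePQ_independent_of_hodgeModel_holds
  have h4 := IsQuaternionAlgebra.finrank_eq_four (K := ℚ) (D := B.endAlgebra)
  haveI : Nontrivial B.endAlgebra := Module.nontrivial_of_finrank_pos (R := ℚ) (by omega)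
  -- the Rosati involution is `x ↦ u⁻¹ x̄ u`, `u² = α < 0`
  have hD : ∀ x : B.endAlgebra, x ≠ 0 → IsUnit x := fun x hx => (isUnit_or_eq_zero_of_isSimple hBs x).resolve_right hx
  have hA4 : HasNoTypeIVFactor B := AbelianVariety.hasNoTypeIVFactor_of_isTotallyReal (K := ℚ)
  have hpos := AbelianVariety.isPositiveAntiInvolution_rosati (A := B) hHD hI ψ
  have h1 := AbelianVariety.isOfFirstKind_rosati (A := B) hHD hI ψ hA4 (K := ℚ)
  obtain ⟨-, h⟩ := (isPositiveAntiInvolution_iff_of_isOfFirstKind ℚ hD h1).mp hpos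
  obtain ⟨u, α, huu, hαneg, hros⟩ : ∃ (u : (B.endAlgebra)ˣ) (α : ℚ), (u : B.endAlgebra) * u = algebraMap ℚ _ α ∧
      (∀ σ : ℚ →+* ℝ, σ α < 0) ∧ ∀ x, AbelianVariety.rosati B hHD hI ψ x = ↑u⁻¹ * standardInvolution ℚ B.endAlgebra x * u := by
    rcases h with ⟨hdef, -⟩ | ⟨-, u, α, huu, hαneg, hros⟩
    · exact absurd (hind.isSplitAtInfinite Rat.infinitePlace) (hdef Rat.infinitePlace)
    · exact ⟨u, α, huu, hαneg, hros⟩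
  have hα : α < 0 := by
    have h' := hαneg (Rat.castHom ℝ)
    rw [eq_ratCast] at h'
    exact_mod_cast h'
  -- `u ∉ ℚ`
  have hubot : (u : B.endAlgebra) ∉ (⊥ : Subalgebra ℚ B.endAlgebra) := by
    rw [Algebra.mem_bot]
    rintro ⟨c, hc⟩
    have h2 : algebraMap ℚ B.endAlgebra (c * c) = algebraMap ℚ B.endAlgebra α := by rw [map_mul, hc, huu]
    have hcc : c * c = α := (algebraMap ℚ B.endAlgebra).injective h2
    nlinarith [mul_self_nonneg c]
  -- a quaternionic basis through `u`
  obtain ⟨β, hα0, hβ0, e, heu⟩ := exists_algEquiv_quaternionAlgebra_apply_eq ℚ hD hubot huu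
  set q := (QuaternionAlgebra.Basis.self ℚ).compHom (e.symm : ℍ[ℚ,α,β] →ₐ[ℚ] B.endAlgebra) with hq
  have hqi : q.i = u := by
    change e.symm ⟨0, 1, 0, 0⟩ = u
    rw [← heu, AlgEquiv.symm_apply_apply]
  have hqj : q.j = e.symm ⟨0, 0, 1, 0⟩ := rfl
  have hstar_i : standardInvolution ℚ B.endAlgebra q.i = -q.i := by
    rw [hqi, ← e.symm_apply_apply (u : B.endAlgebra), heu, standardInvolution_algEquiv, standardInvolution_quaternionAlgebra,
      ← map_neg]
    congr 1
    ext <;> simp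
  have hstar_j : standardInvolution ℚ B.endAlgebra q.j = -q.j := by
    rw [hqj, standardInvolution_algEquiv, standardInvolution_quaternionAlgebra, ← map_neg]
    congr 1
    ext <;> simp
  have hji' : q.j * q.i = -(q.i * q.j) := by rw [q.j_mul_i, q.i_mul_j, zero_smul, zero_sub]
  have hros_i : AbelianVariety.rosati B hHD hI ψ q.i = -q.i := by
    rw [hros, hstar_i, hqi, mul_neg, neg_mul, Units.inv_mul, one_mul]
  have hros_j : AbelianVariety.rosati B hHD hI ψ q.j = q.j := by
    rw [hros, hstar_j, mul_neg, neg_mul, mul_assoc, ← hqi, hji', mul_neg, ← mul_assoc, hqi, Units.inv_mul, one_mul, neg_neg]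
  -- transport along `bettiRep`
  let ρ : B.endAlgebra → Module.End ℚ (bettiCohomology B.X 1) := fun z => MulOpposite.unop (bettiRep B z)
  have hρ : ∀ z, ρ z = MulOpposite.unop (bettiRep B z) := fun z => rfl
  have hρmul : ∀ z w, ρ (z * w) = ρ w * ρ z := fun z w => by rw [hρ, map_mul, MulOpposite.unop_mul]
  have hρneg : ∀ z, ρ (-z) = -ρ z := fun z => by rw [hρ, map_neg, MulOpposite.unop_neg]
  have hρsmul : ∀ (c : ℚ) z, ρ (c • z) = c • ρ z := fun c z => by rw [hρ, map_smul, MulOpposite.unop_smul]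
  have hρone : ρ 1 = 1 := by rw [hρ, map_one, MulOpposite.unop_one]
  have hρA : ∀ z, ρ z ∈ (BettiUniverse.hodge exists_isReal_hodgeModel_holds hB 1).endAlg := fun z => by
    rw [hρ]
    exact Literature.AlgebraicGeometry.ComplexMultiplication.unop_bettiRep_mem_endAlg hHD hI z
  have hτρ : ∀ z, ψ.adjoint (ρ z) = ρ (AbelianVariety.rosati B hHD hI ψ z) := fun z => by
    rw [hρ, hρ, AbelianVariety.unop_bettiRep_rosati]
  refine ⟨α, β, ρ q.i, ρ q.j, hα0, hβ0, ?_, ?_, ?_, hρA q.i, hρA q.j, ?_, ?_⟩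
  · rw [← hρmul, q.i_mul_i, zero_smul, add_zero, hρsmul, hρone, Algebra.algebraMap_eq_smul_one]
  · rw [← hρmul, q.j_mul_j, hρsmul, hρone, Algebra.algebraMap_eq_smul_one]
  · rw [← hρmul, ← hρmul, hji', hρneg]
  · rw [hτρ, hros_i, hρneg]
  · rw [hτρ, hros_j]

/-! ## §2 The count `8 · dim (C(i, j) ∩ 𝔰𝔭(ψ)) = d² + 2d` -/

omit [HodgeTensorFacts.{0, 0}] in
/-- **`8 · dim (C(i, j) ∩ 𝔰𝔭(V, ψ)) = d² + 2d`** (i.e. `dim = d(d+2)/8`) for an anticommuting pair `i² = a`, `j² = b` (`a, b ≠ 0`)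
of endomorphisms of a polarized `ℚ`-Hodge structure with antisymmetric `ψ`, `i` `ψ`-skew and `j` `ψ`-symmetric (`d = dim V`):
the orthogonal-type algebra count `8 dim C⁻ + dim End = 4 dim 𝔰𝔭` and `2 dim 𝔰𝔭 = d(d+1)`.
[cite: Milne1999LefschetzClasses, §2 (type II) and Summary] -/
theorem finrank_centralizer_inf_skewAdjoint_eq_orth {V : Type} [AddCommGroup V] [Module ℚ V] [Module.Finite ℚ V] {n : ℤ}
    {H : HodgeStructure V n} (ψ : H.Polarization) (hflip : ψ.form.flip = -ψ.form) {i j : Module.End ℚ V} {a b : ℚ}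
    (ha : a ≠ 0) (hb : b ≠ 0) (hi : i * i = algebraMap ℚ _ a) (hj : j * j = algebraMap ℚ _ b) (hij : i * j = -(j * i))
    (hτi : ψ.adjoint i = -i) (hτj : ψ.adjoint j = j) :
    8 * Module.finrank ℚ ↥(Subalgebra.toSubmodule (Subalgebra.centralizer ℚ ({i, j} : Set (Module.End ℚ V))) ⊓
        ψ.form.skewAdjointSubmodule) = Module.finrank ℚ V * Module.finrank ℚ V + 2 * Module.finrank ℚ V := by
  let τ : Module.End ℚ V →ₗ[ℚ] Module.End ℚ V :=
    { toFun := ψ.adjoint, map_add' := ψ.adjoint_add, map_smul' := fun c x => ψ.adjoint_smul c x }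
  have hτ : ∀ Y, τ Y = ψ.adjoint Y := fun _ => rfl
  have hτm : ∀ Y Z, τ (Y * Z) = τ Z * τ Y := fun Y Z => by rw [hτ, hτ, hτ, ψ.adjoint_mul]
  have hττ : ∀ Y, τ (τ Y) = Y := fun Y => by rw [hτ, hτ, ψ.adjoint_adjoint]
  have hskew : LinearMap.ker (τ + LinearMap.id) = ψ.form.skewAdjointSubmodule := by
    ext Y
    rw [QuaternionCentralizer.mem_ker_add_id_iff, hτ, LinearMap.mem_skewAdjointSubmodule]
    constructor
    · intro h v w
      rw [Pi.neg_apply, ← LinearMap.neg_apply, ← h]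
      exact (ψ.form_apply_adjoint Y v w).symm
    · intro h
      refine (ψ.eq_adjoint_of_isAdjointPair fun v w => ?_).symm
      rw [h v w, Pi.neg_apply, LinearMap.neg_apply]
  have hs := SymplecticDimension.two_mul_finrank_skewAdjointSubmodule_of_flip_eq_neg ψ.form ψ.nondegenerate hflip
  have hE : Module.finrank ℚ (Module.End ℚ V) = Module.finrank ℚ V * Module.finrank ℚ V := Module.finrank_linearMap _ _ _ _
  have hcount := QuaternionCentralizer.eight_mul_finrank_centralizer_skew_add_orth (K := ℚ) (E := Module.End ℚ V) ha hb hi hj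
    hij τ hτm hττ (by rw [hτ, hτi]) (by rw [hτ, hτj])
  rw [hskew, hE] at hcount
  zify at hcount hs ⊢
  linear_combination hcount + 2 * hs

/-! ## §3 The Lefschetz bound for type II over `ℚ` -/

/-- **The Lefschetz bound, type II over `ℚ`:** for a simple complex abelian variety `B` of dimension `2m` whose endomorphism algebra is
a totally indefinite quaternion algebra over `ℚ`, **`dim Lie Hg(H¹B) ≤ m(2m+1)`** (`= dim 𝔰𝔭_{2m}`): `Lie Hg` commutes with
`End_Hdg(H¹B)` and is `ψ`-skew (Moonen–Zarhin §1 `Hg(X) ⊂ Sp_D(V, φ)`), so it lies in `C(i, j) ∩ 𝔰𝔭(ψ)` for the pair of §1, of dimension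
`d(d+2)/8 = m(2m+1)` (`d = 4m`; Milne's `g²/2 + g/2`, `g = 2m`). [cite: Milne1999LefschetzClasses, §2 (type II) and Summary]
[cite: MoonenZarhin1999LowDim, §1] -/
theorem finrank_hodgeLie_hodge_one_le_of_isTotallyIndefinite {B : AbelianVariety ℂ} {k : ℕ} (hB : IsSmoothProjective k B.X)
    (hBs : B.IsSimple) {m : ℕ} (hBm : B.dim = 2 * m) [IsQuaternionAlgebra ℚ B.endAlgebra]
    (hind : IsTotallyIndefinite ℚ B.endAlgebra) :
    haveI := BettiUniverse.finite hB 1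
    Module.finrank ℚ (BettiUniverse.hodge exists_isReal_hodgeModel_holds hB 1).hodgeLie ≤ m * (2 * m + 1) := by
  classical
  haveI := BettiUniverse.finite hB 1
  set H := BettiUniverse.hodge exists_isReal_hodgeModel_holds hB 1 with hH
  obtain ⟨ψ⟩ := BettiUniverse.hodge_isPolarizable exists_isReal_hodgeModel_holds hB 1
  obtain ⟨a, b, i, j, ha, hb, hi, hj, hij, hiA, hjA, hτi, hτj⟩ := exists_quaternion_pair_of_isTotallyIndefinite hB hBs hind ψ
  have hle : H.hodgeLie ≤ Subalgebra.toSubmodule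
      (Subalgebra.centralizer ℚ ({i, j} : Set (Module.End ℚ (bettiCohomology B.X 1)))) ⊓ ψ.form.skewAdjointSubmodule := by
    intro Y hY
    refine Submodule.mem_inf.2 ⟨?_, ?_⟩
    · rw [Subalgebra.mem_toSubmodule, Subalgebra.mem_centralizer_iff]
      intro g hg
      simp only [Set.mem_insert_iff, Set.mem_singleton_iff] at hg
      rcases hg with rfl | rfl
      · exact (commute_of_mem_hodgeLie H hY ⟨_, hiA⟩).symm
      · exact (commute_of_mem_hodgeLie H hY ⟨_, hjA⟩).symm
    · rw [LinearMap.mem_skewAdjointSubmodule]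
      intro v w
      rw [Pi.neg_apply, map_neg, ← add_eq_zero_iff_eq_neg]
      exact form_apply_add_eq_zero_of_mem_hodgeLie ψ hY v w
  have hflip : ψ.form.flip = -ψ.form := by
    rw [ψ.flip_form, show (((1 : ℕ) : ℤ).negOnePow : ℤˣ) = -1 from Int.negOnePow_one, Units.val_neg, Units.val_one,
      neg_one_zsmul]
  have hcount := finrank_centralizer_inf_skewAdjoint_eq_orth ψ hflip ha hb hi hj hij hτi hτj
  have hdimV : Module.finrank ℚ (bettiCohomology B.X 1) = 4 * m := by
    rw [finrank_bettiCohomology_one_eq_two_mul_dim B, hBm]; ring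
  rw [hdimV] at hcount
  refine (Submodule.finrank_mono hle).trans (le_of_eq ?_)
  nlinarith [hcount]

/-- **`dim MT(H¹B) ≤ m(2m+1) + 1`** for `B` simple of dimension `2m > 0` with `End⁰B` a totally indefinite quaternion algebra over `ℚ`.
[cite: Milne1999LefschetzClasses, §2 (type II) and Summary] [cite: MoonenZarhin1999LowDim, §1] -/
theorem mtRank_hodge_one_le_of_isTotallyIndefinite {B : AbelianVariety ℂ} {k : ℕ} (hB : IsSmoothProjective k B.X)
    (hBs : B.IsSimple) {m : ℕ} (hm : 0 < m) (hBm : B.dim = 2 * m) [IsQuaternionAlgebra ℚ B.endAlgebra]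
    (hind : IsTotallyIndefinite ℚ B.endAlgebra) :
    haveI := BettiUniverse.finite hB 1
    (BettiUniverse.hodge exists_isReal_hodgeModel_holds hB 1).mtRank ≤ m * (2 * m + 1) + 1 := by
  haveI := BettiUniverse.finite hB 1
  have h0 : 0 < B.dim := by omega
  have h := finrank_hodgeLie_hodge_one_le_of_isTotallyIndefinite hB hBs hBm hind
  rw [mtRank_hodge_one_eq_finrank_hodgeLie_add_one hB h0]
  omega

/-! ## §4 Fourfolds: `dim MT(H¹B) ∈ {7, 9, 10, 11}` -/

/-- **A simple abelian FOURFOLD with totally indefinite quaternion multiplication over `ℚ` (type II, `m = 2`) has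
`dim MT(H¹B) ∈ {7, 9, 10, 11}`**, no factor of type IV, `𝔷 = 0`, and is not of CM type: `t ≤ 11` (§3); `t ≥ 4` (not CM), `t ≠ 4`
(`dim_ℚ End⁰B = 4 ≠ 16`), `t ∉ {5, 6, 8}` (no type IV) by the lower rungs.  (In print `Hg = Sp_D(V, φ)`, i.e. `t = 11`, by Moonen–Zarhin
Thm. (0.1) (4); the values `7, 9, 10` are not yet excluded in the tree — `7` is the type-III position, see the lane card.)
[cite: MoonenZarhin1999LowDim, §1 and Thm. (0.1) (4)]
[cite: Milne1999LefschetzClasses, §2 (type II) and Summary] -/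
theorem mtRank_hodge_one_mem_of_isSimple_fourfold_of_isTotallyIndefinite {B : AbelianVariety ℂ} {k : ℕ}
    (hB : IsSmoothProjective k B.X) (hBs : B.IsSimple) (hB4 : B.dim = 4) [IsQuaternionAlgebra ℚ B.endAlgebra]
    (hind : IsTotallyIndefinite ℚ B.endAlgebra) :
    haveI := BettiUniverse.finite hB 1
    ((BettiUniverse.hodge exists_isReal_hodgeModel_holds hB 1).mtRank = 7 ∨
      (BettiUniverse.hodge exists_isReal_hodgeModel_holds hB 1).mtRank = 9 ∨
      (BettiUniverse.hodge exists_isReal_hodgeModel_holds hB 1).mtRank = 10 ∨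
      (BettiUniverse.hodge exists_isReal_hodgeModel_holds hB 1).mtRank = 11) ∧ HasNoTypeIVFactor B ∧
      (BettiUniverse.hodge exists_isReal_hodgeModel_holds hB 1).hodgeLie ⊓
        Subalgebra.toSubmodule (BettiUniverse.hodge exists_isReal_hodgeModel_holds hB 1).endAlg = ⊥ ∧
      ¬ IsOfCMType B := by
  have hk : B.dim = k := schemeDim_eq_holds hB
  subst hk
  haveI := BettiUniverse.finite hB 1
  have hB0 : 0 < B.dim := by omega
  have hE4 : Module.finrank ℚ B.endAlgebra = 4 := IsQuaternionAlgebra.finrank_eq_four (K := ℚ) (D := B.endAlgebra)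
  have hA4 : HasNoTypeIVFactor B := AbelianVariety.hasNoTypeIVFactor_of_isTotallyReal (K := ℚ)
  have hz := hodgeLie_hodge_one_inf_endAlg_eq_bot_of_hasNoTypeIVFactor hB hA4
  have hcm : ¬ IsOfCMType B := not_isOfCMType_of_hasNoTypeIVFactor hB hB0 hA4
  have h11 := mtRank_hodge_one_le_of_isTotallyIndefinite hB hBs (m := 2) (by norm_num) (by rw [hB4]) hind
  obtain ⟨-, -, h5, h6, h8⟩ := mtRank_hodge_one_ne_of_hasNoTypeIVFactor hB hB0 hA4
  have h4 := four_le_mtRank_hodge_one_of_not_isOfCMType hB hcm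
  have hne4 : (BettiUniverse.hodge exists_isReal_hodgeModel_holds hB 1).mtRank ≠ 4 := by
    intro h
    obtain ⟨hsq, -, -⟩ := finrank_endAlgebra_eq_dim_sq_of_not_isOfCMType hB hB0 hcm h.le
    rw [hE4, hB4] at hsq
    norm_num at hsq
  refine ⟨?_, hA4, hz, hcm⟩
  omega

/-! ## §5 Every quaternion fourfold over `ℚ`: `dim MT(H¹B) ∈ {7, 9, 10, 11}`, with `7` in the definite case -/

omit [HodgeTensorFacts.{0, 0}] in
/-- Over `ℚ` a quaternion algebra is totally definite or totally indefinite (one infinite place). [folklore] -/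
private theorem isTotallyDefinite_or_isTotallyIndefinite (D : Type) [Ring D] [Algebra ℚ D] :
    IsTotallyDefinite ℚ D ∨ Literature.RingTheory.CentralSimple.IsTotallyIndefinite ℚ D := by
  by_cases h : Literature.NumberTheory.Automorphic.IsSplitAtInfinite D Rat.infinitePlace
  · exact Or.inr ⟨fun w => by rwa [Subsingleton.elim w Rat.infinitePlace]⟩
  · exact Or.inl fun w => by rwa [Subsingleton.elim w Rat.infinitePlace]

/-- **Every simple complex abelian FOURFOLD whose endomorphism algebra is a quaternion algebra over `ℚ` has
`dim MT(H¹B) ∈ {7, 9, 10, 11}`**, no factor of type IV, `𝔷 = 0`, and is not of CM type; **in the totally definite case (type III)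
`dim MT(H¹B) = 7`** (`CorCM/MumfordTateRankSevenTypeThreeConverse`), in the totally indefinite case (type II) §4.  Over `ℚ` a
quaternion algebra is one or the other (one infinite place). [cite: MoonenZarhin1999LowDim, §1 and Thm. (0.1) (2), (4)]
[cite: Milne1999LefschetzClasses, §2 (types II, III) and Summary] -/
theorem mtRank_hodge_one_mem_of_isSimple_quaternion_fourfold {B : AbelianVariety ℂ} {k : ℕ} (hB : IsSmoothProjective k B.X)
    (hBs : B.IsSimple) (hB4 : B.dim = 4) [IsQuaternionAlgebra ℚ B.endAlgebra] :
    haveI := BettiUniverse.finite hB 1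
    ((BettiUniverse.hodge exists_isReal_hodgeModel_holds hB 1).mtRank = 7 ∨
      (BettiUniverse.hodge exists_isReal_hodgeModel_holds hB 1).mtRank = 9 ∨
      (BettiUniverse.hodge exists_isReal_hodgeModel_holds hB 1).mtRank = 10 ∨
      (BettiUniverse.hodge exists_isReal_hodgeModel_holds hB 1).mtRank = 11) ∧
      (IsTotallyDefinite ℚ B.endAlgebra → (BettiUniverse.hodge exists_isReal_hodgeModel_holds hB 1).mtRank = 7) ∧
      HasNoTypeIVFactor B ∧
      (BettiUniverse.hodge exists_isReal_hodgeModel_holds hB 1).hodgeLie ⊓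
        Subalgebra.toSubmodule (BettiUniverse.hodge exists_isReal_hodgeModel_holds hB 1).endAlg = ⊥ ∧
      ¬ IsOfCMType B := by
  rcases isTotallyDefinite_or_isTotallyIndefinite B.endAlgebra with hdef | hind
  · obtain ⟨h7, hA4, hz, hcm⟩ := mtRank_hodge_one_eq_seven_of_isSimple_fourfold_of_isTotallyDefinite hB hBs hB4 hdef
    exact ⟨Or.inl h7, fun _ => h7, hA4, hz, hcm⟩
  · obtain ⟨h, hA4, hz, hcm⟩ := mtRank_hodge_one_mem_of_isSimple_fourfold_of_isTotallyIndefinite hB hBs hB4 hind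
    exact ⟨h, fun hdef => absurd (hind.isSplitAtInfinite Rat.infinitePlace) (hdef Rat.infinitePlace), hA4, hz, hcm⟩

end Summit.HodgeConjecture.CorCM

end
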